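import Summits.CriticalPhenomena.PercolationContinuityZ3.Theorems.PercNearOneGluingNoHeavyLowerTailSahiOneStepLayerPositive
import Summits.CriticalPhenomena.PercolationContinuityZ3.Theorems.PercNearOneGluingNoHeavyLowerTailSahiOneStepGaleFKG
import Summits.CriticalPhenomena.PercolationContinuityZ3.Theorems.PercNearOneGluingNoHeavyLowerTailSahiOneStepOppositeShifted
import Summits.CriticalPhenomena.PercolationContinuityZ3.Theorems.PercNearOneGluingNoHeavyLowerTailSahiOneStepFreeStep
import Summits.CriticalPhenomena.PercolationContinuityZ3.Theorems.PercNearOneGluingNoHeavyLowerTailSahiOneStepWeightedMajority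
import Summits.CriticalPhenomena.PercolationContinuityZ3.Theorems.PercNearOneGluingNoHeavyLowerTailSahiOneStepDensityClosure
import HarnessLib

/-!
# `(2′)` and Kahn C5 / Sahi C₃ for ANY TWO EVENTS SHIFTED W.R.T. A COMMON ORDER, every product measure — assembly, free coordinates,
# and the corollary for weighted-majority games with identical or reversed weight rankings

Support file (prover prim-ineq-prove-3 gen 30; `--supports stmt-CriticalPhenomena-4575`; memo
`run/shared/lean/prim/prim-ineq-prove-3/FINDING-G30-SHIFTED-PAIRS.md` §2–3).  No definitions, no named facts, no sorries, no `native_decide`.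

* SAME DIRECTION (`…SahiOneStepGaleFKG` + `…SahiOneStepLayerPositive`): **`osN_threshold_nonneg_of_rightShifted`**,
  **`sahiE3_threshold_nonneg_of_rightShifted`**, `…_of_leftShifted` — for every `p : ι → [0,1]`, every block `F` of a linearly ordered index
  type, every `t`, and increasing `F`-determined `A, B` both right-shifted on `F` (`ω ∈ A`, `i < j` in `F`, `i ∈ ω`, `j ∉ ω` ⟹
  `insert j (ω ∖ {i}) ∈ A`), resp. both left-shifted:  `0 ≤ n(Th_t(F); 1_A, 1_B)` and `0 ≤ E₃(1_{Th_t(F)}, 1_A, 1_B)`.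
* FREE COORDINATES (`osN_threshold_nonneg_of_sections`): the events may depend on coordinates outside `F` — `…_of_rightShifted_free`,
  `…_of_oppositeShifted_free` (`A, B` determined by any `G ⊇ F`, shifted on `F` only).
* **WEIGHTED MAJORITIES** (`sahiE3_threshold_weightedMajority_nonneg`, `…_reversed_nonneg`): for nonnegative weights `w, w'` on `F` whose rankings
  along the order of `ι` are both nondecreasing, or one nondecreasing and one nonincreasing, every `p ∈ [0,1]^ι`, all quotas:
  `0 ≤ E₃(1_{Th_t(F)}, 1_{[Σ_{F∩ω} w ≥ θ]}, 1_{[Σ_{F∩ω} w' ≥ θ']})`.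
In game-theoretic terms: Kahn C5 / Sahi C₃ with a Hamming-threshold first slot holds for any two complete simple games on `F` whose desirability
orders are identical or exactly reversed, at every density vector.
-/

noncomputable section

namespace Summit.CriticalPhenomena.PercolationContinuityZ3.Theorems

namespace SahiOneStep

open MeasureTheory Finset
open Literature.Probability.Percolation (DeterminedBy determinedBy_iff)
open Literature.Probability.LatticeModels (prodBernoulli sahiE3)
open Literature.Probability.Percolation.DecisionTree (ind)
open SahiE3Sections (determinedBy_section_insert determinedBy_section_sdiff)
open scoped Classical

variable {ι : Type*} [Fintype ι] [LinearOrder ι]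

/-! ## §1 Same-direction shifted pairs -/

omit [Fintype ι] in
/-- Set-level right-shiftedness gives the pattern-level hypothesis of `…SahiOneStepGaleFKG`. [this work] -/
theorem pattern_rightShifted {F : Finset ι} {A : Set (Set ι)}
    (hAs : ∀ ω ∈ A, ∀ i ∈ F, ∀ j ∈ F, i < j → i ∈ ω → j ∉ ω → insert j (ω \ {i}) ∈ A) :
    ∀ T : Finset ι, T ⊆ F → (↑T : Set ι) ∈ A → ∀ i ∈ T, ∀ j ∈ F, j ∉ T → i < j → (↑(insert j (T.erase i)) : Set ι) ∈ A := by
  intro T hTF hT i hi j hj hjT hij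
  rw [Finset.coe_insert, Finset.coe_erase]
  exact hAs _ hT i (hTF hi) j hj hij (Finset.mem_coe.2 hi) (fun h => hjT (Finset.mem_coe.1 h))

/-- **THE `(2′)` HALF FOR TWO RIGHT-SHIFTED EVENTS, EVERY PRODUCT MEASURE.**  For `A, B` increasing, determined by `F`, both right-shifted on `F`:
`0 ≤ n(Th_t(F); 1_A, 1_B)`, i.e. `Cov(1_A,1_B) ≥ μ(N_F < t)·Cov(1_A,1_B ∣ N_F < t)`. [this work] -/
theorem osN_threshold_nonneg_of_rightShifted (p : ι → unitInterval) (F : Finset ι) (t : ℕ) {A B : Set (Set ι)}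
    (hA : IsUpperSet A) (hB : IsUpperSet B) (hAF : DeterminedBy A (↑F : Set ι)) (hBF : DeterminedBy B (↑F : Set ι))
    (hAs : ∀ ω ∈ A, ∀ i ∈ F, ∀ j ∈ F, i < j → i ∈ ω → j ∉ ω → insert j (ω \ {i}) ∈ A)
    (hBs : ∀ ω ∈ B, ∀ i ∈ F, ∀ j ∈ F, i < j → i ∈ ω → j ∉ ω → insert j (ω \ {i}) ∈ B) :
    0 ≤ osN p {ω : Set ι | t ≤ (F.filter (· ∈ ω)).card} (ind A) (ind B) :=
  osN_threshold_nonneg_of_layerPos p F t hA hB fun k _ =>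
    real_layer_mul_le_of_rightShifted p F hAF hBF (pattern_rightShifted hAs) (pattern_rightShifted hBs) k

/-- **KAHN C5 / SAHI `C₃` FOR TWO RIGHT-SHIFTED EVENTS, EVERY PRODUCT MEASURE**: `0 ≤ E₃(1_{Th_t(F)}, 1_A, 1_B)`. [this work] -/
theorem sahiE3_threshold_nonneg_of_rightShifted (p : ι → unitInterval) (F : Finset ι) (t : ℕ) {A B : Set (Set ι)}
    (hA : IsUpperSet A) (hB : IsUpperSet B) (hAF : DeterminedBy A (↑F : Set ι)) (hBF : DeterminedBy B (↑F : Set ι))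
    (hAs : ∀ ω ∈ A, ∀ i ∈ F, ∀ j ∈ F, i < j → i ∈ ω → j ∉ ω → insert j (ω \ {i}) ∈ A)
    (hBs : ∀ ω ∈ B, ∀ i ∈ F, ∀ j ∈ F, i < j → i ∈ ω → j ∉ ω → insert j (ω \ {i}) ∈ B) :
    0 ≤ sahiE3 (prodBernoulli p) {ω : Set ι | t ≤ (F.filter (· ∈ ω)).card} A B := by
  rw [← osT_ind_ind, osT_eq_osMp_add_osN]
  exact add_nonneg (osMp_threshold_nonneg_all p F t hA hB) (osN_threshold_nonneg_of_rightShifted p F t hA hB hAF hBF hAs hBs)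

/-- **Two LEFT-shifted events** (`ω ∈ A`, `j < i` in `F`, `i ∈ ω`, `j ∉ ω` ⟹ `insert j (ω ∖ {i}) ∈ A`), every product measure:
`0 ≤ n(Th_t(F); 1_A, 1_B)` (order reversal of `osN_threshold_nonneg_of_rightShifted`). [this work] -/
theorem osN_threshold_nonneg_of_leftShifted (p : ι → unitInterval) (F : Finset ι) (t : ℕ) {A B : Set (Set ι)}
    (hA : IsUpperSet A) (hB : IsUpperSet B) (hAF : DeterminedBy A (↑F : Set ι)) (hBF : DeterminedBy B (↑F : Set ι))
    (hAs : ∀ ω ∈ A, ∀ i ∈ F, ∀ j ∈ F, j < i → i ∈ ω → j ∉ ω → insert j (ω \ {i}) ∈ A)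
    (hBs : ∀ ω ∈ B, ∀ i ∈ F, ∀ j ∈ F, j < i → i ∈ ω → j ∉ ω → insert j (ω \ {i}) ∈ B) :
    0 ≤ osN p {ω : Set ι | t ≤ (F.filter (· ∈ ω)).card} (ind A) (ind B) :=
  osN_threshold_nonneg_of_rightShifted (ι := ιᵒᵈ) p F t hA hB hAF hBF
    (fun ω hω i hi j hj hij => hAs ω hω i hi j hj hij) (fun ω hω i hi j hj hij => hBs ω hω i hi j hj hij)

/-- **Kahn C5 / Sahi `C₃` for two left-shifted events**, every product measure. [this work] -/
theorem sahiE3_threshold_nonneg_of_leftShifted (p : ι → unitInterval) (F : Finset ι) (t : ℕ) {A B : Set (Set ι)}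
    (hA : IsUpperSet A) (hB : IsUpperSet B) (hAF : DeterminedBy A (↑F : Set ι)) (hBF : DeterminedBy B (↑F : Set ι))
    (hAs : ∀ ω ∈ A, ∀ i ∈ F, ∀ j ∈ F, j < i → i ∈ ω → j ∉ ω → insert j (ω \ {i}) ∈ A)
    (hBs : ∀ ω ∈ B, ∀ i ∈ F, ∀ j ∈ F, j < i → i ∈ ω → j ∉ ω → insert j (ω \ {i}) ∈ B) :
    0 ≤ sahiE3 (prodBernoulli p) {ω : Set ι | t ≤ (F.filter (· ∈ ω)).card} A B := by
  rw [← osT_ind_ind, osT_eq_osMp_add_osN]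
  exact add_nonneg (osMp_threshold_nonneg_all p F t hA hB) (osN_threshold_nonneg_of_leftShifted p F t hA hB hAF hBF hAs hBs)

/-! ## §2 Free coordinates: events determined by a larger block `G ⊇ F`, shifted on `F` only -/

omit [Fintype ι] [LinearOrder ι] in
/-- A trade `insert j (ω ∖ {i})` is the trade `(ω ∖ {i}) ∪ {j}` of `…OppositeShifted`. [folklore] -/
theorem insert_sdiff_eq_trade (ω : Set ι) (i j : ι) : insert j (ω \ {i}) = (ω \ {i}) ∪ {j} := by
  rw [Set.union_singleton]

omit [LinearOrder ι] in
/-- **Free-coordinate peeling for a trade-closed pair.**  If `(2′)` at the slot `Th_t(F)` holds for every pair of increasing `F`-determined events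
closed under the trade relations `R_A`, `R_B` on `F`, then it holds for every pair of increasing events determined by some `G ⊇ F` and closed under
the same trades (induction on `#G − #F` via `osN_threshold_nonneg_of_sections`; sections at a free coordinate stay trade-closed). [this work] -/
theorem osN_threshold_nonneg_free_of_closed (p : ι → unitInterval) (F : Finset ι) (t : ℕ) (RA RB : ι → ι → Prop)
    (hbase : ∀ A B : Set (Set ι), IsUpperSet A → IsUpperSet B → DeterminedBy A (↑F : Set ι) → DeterminedBy B (↑F : Set ι) →
      (∀ ω ∈ A, ∀ x ∈ F, ∀ y ∈ F, RA x y → x ∈ ω → y ∉ ω → (ω \ {x}) ∪ {y} ∈ A) →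
      (∀ ω ∈ B, ∀ x ∈ F, ∀ y ∈ F, RB x y → x ∈ ω → y ∉ ω → (ω \ {x}) ∪ {y} ∈ B) →
      0 ≤ osN p {ω : Set ι | t ≤ (F.filter (· ∈ ω)).card} (ind A) (ind B)) :
    ∀ (n : ℕ) (G : Finset ι) (A B : Set (Set ι)), G.card = F.card + n → F ⊆ G → IsUpperSet A → IsUpperSet B →
      DeterminedBy A (↑G : Set ι) → DeterminedBy B (↑G : Set ι) →
      (∀ ω ∈ A, ∀ x ∈ F, ∀ y ∈ F, RA x y → x ∈ ω → y ∉ ω → (ω \ {x}) ∪ {y} ∈ A) →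
      (∀ ω ∈ B, ∀ x ∈ F, ∀ y ∈ F, RB x y → x ∈ ω → y ∉ ω → (ω \ {x}) ∪ {y} ∈ B) →
      0 ≤ osN p {ω : Set ι | t ≤ (F.filter (· ∈ ω)).card} (ind A) (ind B) := by
  intro n
  induction n with
  | zero =>
    intro G A B hG hFG hA hB hAG hBG hAs hBs
    have hGF : G = F := (Finset.eq_of_subset_of_card_le hFG (by omega)).symm
    rw [hGF] at hAG hBG
    exact hbase A B hA hB hAG hBG hAs hBs
  | succ n ih =>
    intro G A B hG hFG hA hB hAG hBG hAs hBs
    obtain ⟨e, heG, heF⟩ : ∃ e ∈ G, e ∉ F := Finset.exists_mem_notMem_of_card_lt_card (by omega)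
    have hFG' : F ⊆ G.erase e := fun i hi => Finset.mem_erase.2 ⟨fun h => heF (h ▸ hi), hFG hi⟩
    have hcard : (G.erase e).card = F.card + n := by rw [Finset.card_erase_of_mem heG, hG]; omega
    have hcoe : (↑G : Set ι) \ {e} = ↑(G.erase e) := by rw [Finset.coe_erase]
    refine osN_threshold_nonneg_of_sections p F t hA hB heF ?_ ?_ ?_ ?_
    · exact ih (G.erase e) _ _ hcard hFG' (isUpperSet_section_insert hA e) (isUpperSet_section_insert hB e)
        (hcoe ▸ determinedBy_section_insert hAG e) (hcoe ▸ determinedBy_section_insert hBG e)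
        (section_insert_closed heF hAs) (section_insert_closed heF hBs)
    · exact ih (G.erase e) _ _ hcard hFG' (isUpperSet_section_sdiff hA e) (isUpperSet_section_sdiff hB e)
        (hcoe ▸ determinedBy_section_sdiff hAG e) (hcoe ▸ determinedBy_section_sdiff hBG e)
        (section_sdiff_closed heF hAs) (section_sdiff_closed heF hBs)
    · exact ih (G.erase e) _ _ hcard hFG' (isUpperSet_section_insert hA e) (isUpperSet_section_sdiff hB e)
        (hcoe ▸ determinedBy_section_insert hAG e) (hcoe ▸ determinedBy_section_sdiff hBG e)
        (section_insert_closed heF hAs) (section_sdiff_closed heF hBs)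
    · exact ih (G.erase e) _ _ hcard hFG' (isUpperSet_section_sdiff hA e) (isUpperSet_section_insert hB e)
        (hcoe ▸ determinedBy_section_sdiff hAG e) (hcoe ▸ determinedBy_section_insert hBG e)
        (section_sdiff_closed heF hAs) (section_insert_closed heF hBs)

/-- **Two right-shifted-on-`F` events determined by any `G ⊇ F`** (coordinates outside `F` free), every product measure:
`0 ≤ n(Th_t(F); 1_A, 1_B)`. [this work] -/
theorem osN_threshold_nonneg_of_rightShifted_free (p : ι → unitInterval) {F G : Finset ι} (hFG : F ⊆ G) (t : ℕ) {A B : Set (Set ι)}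
    (hA : IsUpperSet A) (hB : IsUpperSet B) (hAG : DeterminedBy A (↑G : Set ι)) (hBG : DeterminedBy B (↑G : Set ι))
    (hAs : ∀ ω ∈ A, ∀ i ∈ F, ∀ j ∈ F, i < j → i ∈ ω → j ∉ ω → insert j (ω \ {i}) ∈ A)
    (hBs : ∀ ω ∈ B, ∀ i ∈ F, ∀ j ∈ F, i < j → i ∈ ω → j ∉ ω → insert j (ω \ {i}) ∈ B) :
    0 ≤ osN p {ω : Set ι | t ≤ (F.filter (· ∈ ω)).card} (ind A) (ind B) := by
  refine osN_threshold_nonneg_free_of_closed p F t (fun x y => x < y) (fun x y => x < y)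
    (fun A B hA hB hAF hBF hAs hBs => osN_threshold_nonneg_of_rightShifted p F t hA hB hAF hBF
      (fun ω hω i hi j hj hij hiω hjω => (insert_sdiff_eq_trade ω i j) ▸ hAs ω hω i hi j hj hij hiω hjω)
      (fun ω hω i hi j hj hij hiω hjω => (insert_sdiff_eq_trade ω i j) ▸ hBs ω hω i hi j hj hij hiω hjω))
    (G.card - F.card) G A B (by have := Finset.card_le_card hFG; omega) hFG hA hB hAG hBG ?_ ?_
  · intro ω hω x hx y hy hxy hxω hyω; rw [← insert_sdiff_eq_trade]; exact hAs ω hω x hx y hy hxy hxω hyω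
  · intro ω hω x hx y hy hxy hxω hyω; rw [← insert_sdiff_eq_trade]; exact hBs ω hω x hx y hy hxy hxω hyω

/-- **Kahn C5 / Sahi `C₃`, two right-shifted-on-`F` events determined by any `G ⊇ F`**, every product measure. [this work] -/
theorem sahiE3_threshold_nonneg_of_rightShifted_free (p : ι → unitInterval) {F G : Finset ι} (hFG : F ⊆ G) (t : ℕ) {A B : Set (Set ι)}
    (hA : IsUpperSet A) (hB : IsUpperSet B) (hAG : DeterminedBy A (↑G : Set ι)) (hBG : DeterminedBy B (↑G : Set ι))
    (hAs : ∀ ω ∈ A, ∀ i ∈ F, ∀ j ∈ F, i < j → i ∈ ω → j ∉ ω → insert j (ω \ {i}) ∈ A)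
    (hBs : ∀ ω ∈ B, ∀ i ∈ F, ∀ j ∈ F, i < j → i ∈ ω → j ∉ ω → insert j (ω \ {i}) ∈ B) :
    0 ≤ sahiE3 (prodBernoulli p) {ω : Set ι | t ≤ (F.filter (· ∈ ω)).card} A B := by
  rw [← osT_ind_ind, osT_eq_osMp_add_osN]
  exact add_nonneg (osMp_threshold_nonneg_all p F t hA hB) (osN_threshold_nonneg_of_rightShifted_free p hFG t hA hB hAG hBG hAs hBs)

omit [LinearOrder ι] in
/-- **An opposite-shifted-on-`F` pair determined by any `G ⊇ F`** (ranking `σ` injective on `F`), EVERY density vector `p ∈ [0,1]^ι`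
(interior densities by THEOREM S′ and free-coordinate peeling, the boundary by continuity, `osN_nonneg_of_forall_interior`):
`0 ≤ n(Th_t(F); 1_A, 1_B)`. [this work] -/
theorem osN_threshold_nonneg_of_oppositeShifted_free (p : ι → unitInterval) (σ : ι → ℕ) {F G : Finset ι} (hFG : F ⊆ G)
    (hσ : Set.InjOn σ (↑F : Set ι)) (t : ℕ) {A B : Set (Set ι)}
    (hA : IsUpperSet A) (hB : IsUpperSet B) (hAG : DeterminedBy A (↑G : Set ι)) (hBG : DeterminedBy B (↑G : Set ι))
    (hAs : ∀ ω ∈ A, ∀ x ∈ F, ∀ y ∈ F, σ y < σ x → x ∈ ω → y ∉ ω → (ω \ {x}) ∪ {y} ∈ A)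
    (hBs : ∀ ω ∈ B, ∀ x ∈ F, ∀ y ∈ F, σ x < σ y → x ∈ ω → y ∉ ω → (ω \ {x}) ∪ {y} ∈ B) :
    0 ≤ osN p {ω : Set ι | t ≤ (F.filter (· ∈ ω)).card} (ind A) (ind B) :=
  osN_nonneg_of_forall_interior _ _ _ (fun q hq =>
    osN_threshold_nonneg_free_of_closed q F t (fun x y => σ y < σ x) (fun x y => σ x < σ y)
      (fun A B hA hB hAF hBF hAs hBs => osN_threshold_nonneg_of_oppositeShifted q σ F hσ (fun i _ => hq i) t hA hB hAF hBF hAs hBs)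
      (G.card - F.card) G A B (by have := Finset.card_le_card hFG; omega) hFG hA hB hAG hBG hAs hBs) p

omit [LinearOrder ι] in
/-- **Kahn C5 / Sahi `C₃`, opposite-shifted-on-`F` pair determined by any `G ⊇ F`**, every density vector. [this work] -/
theorem sahiE3_threshold_nonneg_of_oppositeShifted_free (p : ι → unitInterval) (σ : ι → ℕ) {F G : Finset ι} (hFG : F ⊆ G)
    (hσ : Set.InjOn σ (↑F : Set ι)) (t : ℕ) {A B : Set (Set ι)}
    (hA : IsUpperSet A) (hB : IsUpperSet B) (hAG : DeterminedBy A (↑G : Set ι)) (hBG : DeterminedBy B (↑G : Set ι))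
    (hAs : ∀ ω ∈ A, ∀ x ∈ F, ∀ y ∈ F, σ y < σ x → x ∈ ω → y ∉ ω → (ω \ {x}) ∪ {y} ∈ A)
    (hBs : ∀ ω ∈ B, ∀ x ∈ F, ∀ y ∈ F, σ x < σ y → x ∈ ω → y ∉ ω → (ω \ {x}) ∪ {y} ∈ B) :
    0 ≤ sahiE3 (prodBernoulli p) {ω : Set ι | t ≤ (F.filter (· ∈ ω)).card} A B := by
  rw [← osT_ind_ind, osT_eq_osMp_add_osN]
  exact add_nonneg (osMp_threshold_nonneg_all p F t hA hB)
    (osN_threshold_nonneg_of_oppositeShifted_free p σ hFG hσ t hA hB hAG hBG hAs hBs)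

/-! ## §3 Weighted-majority games (structure lemmas: `…SahiOneStepWeightedMajority`) -/

/-- **KAHN C5 / SAHI `C₃` FOR TWO WEIGHTED-MAJORITY GAMES WITH A COMMON WEIGHT RANKING, EVERY PRODUCT MEASURE.**  If the nonnegative weight
vectors `w, w'` are both nondecreasing along the order of `ι` on `F`, then for every `p : ι → [0,1]`, every `t` and all quotas `θ, θ'`:
`0 ≤ E₃(1_{Th_t(F)}, 1_{[Σ_{i∈F∩ω} w_i ≥ θ]}, 1_{[Σ_{i∈F∩ω} w'_i ≥ θ']})`. [this work] -/
theorem sahiE3_threshold_weightedMajority_nonneg (p : ι → unitInterval) (F : Finset ι) (t : ℕ) {w w' : ι → ℝ}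
    (hw : ∀ i ∈ F, 0 ≤ w i) (hw' : ∀ i ∈ F, 0 ≤ w' i)
    (hmono : ∀ i ∈ F, ∀ j ∈ F, i < j → w i ≤ w j) (hmono' : ∀ i ∈ F, ∀ j ∈ F, i < j → w' i ≤ w' j) (θ θ' : ℝ) :
    0 ≤ sahiE3 (prodBernoulli p) {ω : Set ι | t ≤ (F.filter (· ∈ ω)).card}
      {ω : Set ι | θ ≤ ∑ i ∈ F.filter (· ∈ ω), w i} {ω : Set ι | θ' ≤ ∑ i ∈ F.filter (· ∈ ω), w' i} :=
  sahiE3_threshold_nonneg_of_rightShifted p F t (isUpperSet_weightedMajority F hw θ) (isUpperSet_weightedMajority F hw' θ')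
    (determinedBy_weightedMajority F w θ) (determinedBy_weightedMajority F w' θ')
    (fun ω hω i hi j hj hij hiω hjω => (insert_sdiff_eq_trade ω i j) ▸
      tradeClosed_weightedMajority F (R := fun x y => x < y) hmono θ ω hω i hi j hj hij hiω hjω)
    (fun ω hω i hi j hj hij hiω hjω => (insert_sdiff_eq_trade ω i j) ▸
      tradeClosed_weightedMajority F (R := fun x y => x < y) hmono' θ' ω hω i hi j hj hij hiω hjω)

omit [LinearOrder ι] in
/-- **KAHN C5 / SAHI `C₃` FOR TWO WEIGHTED-MAJORITY GAMES WITH REVERSED WEIGHT RANKINGS** (`σ` a ranking injective on `F`, `w` nonincreasing and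
`w'` nondecreasing along `σ`, nonnegative; every `p ∈ [0,1]^ι`): `0 ≤ E₃(1_{Th_t(F)}, 1_{[Σ_{F∩ω} w ≥ θ]}, 1_{[Σ_{F∩ω} w' ≥ θ']})`. [this work] -/
theorem sahiE3_threshold_weightedMajority_reversed_nonneg (p : ι → unitInterval) (σ : ι → ℕ) (F : Finset ι) (hσ : Set.InjOn σ (↑F : Set ι))
    (t : ℕ) {w w' : ι → ℝ} (hw : ∀ i ∈ F, 0 ≤ w i) (hw' : ∀ i ∈ F, 0 ≤ w' i)
    (hanti : ∀ i ∈ F, ∀ j ∈ F, σ i < σ j → w j ≤ w i) (hmono' : ∀ i ∈ F, ∀ j ∈ F, σ i < σ j → w' i ≤ w' j) (θ θ' : ℝ) :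
    0 ≤ sahiE3 (prodBernoulli p) {ω : Set ι | t ≤ (F.filter (· ∈ ω)).card}
      {ω : Set ι | θ ≤ ∑ i ∈ F.filter (· ∈ ω), w i} {ω : Set ι | θ' ≤ ∑ i ∈ F.filter (· ∈ ω), w' i} :=
  sahiE3_threshold_nonneg_of_oppositeShifted_free p σ (subset_refl F) hσ t (isUpperSet_weightedMajority F hw θ) (isUpperSet_weightedMajority F hw' θ')
    (determinedBy_weightedMajority F w θ) (determinedBy_weightedMajority F w' θ')
    (tradeClosed_weightedMajority F (R := fun x y => σ y < σ x) (fun x hx y hy hyx => hanti y hy x hx hyx) θ)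
    (tradeClosed_weightedMajority F (R := fun x y => σ x < σ y) (fun x hx y hy hxy => hmono' x hx y hy hxy) θ')

end SahiOneStep

end Summit.CriticalPhenomena.PercolationContinuityZ3.Theorems
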